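import Summits.ResolutionOfSingularities.ResolutionOfSingularities.Theorems.EigenLadderLU3
import HarnessLib

/-!
# EigenLadderLU (4) — PART F: THE DATUM-PRODUCING LAW for a diagonal tame chart
(`galoisHenselDescentDatum_of_diagonalChart`, decided modulo `TheoremD k`)
-/

namespace Summit.ResolutionOfSingularities.ResolutionOfSingularities.Theorems.EigenLadderLU

open Polynomial
open Literature.AlgebraicGeometry.Resolution
open Summit.ResolutionOfSingularities.ResolutionOfSingularities.Theorems
open Summit.ResolutionOfSingularities.ResolutionOfSingularities.Theorems.AdaptedChartHensel
open Summit.ResolutionOfSingularities.ResolutionOfSingularities.Theorems.GaloisDescentLU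
open Summit.ResolutionOfSingularities.ResolutionOfSingularities.Theorems.KeyChainLU


/-! ## PART F — THE LAW FOR A GENERAL DIAGONAL TAME ACTION (frame NOT given in advance; decided
modulo THEOREM D) and the KUMMER LAW as its corollary -/

section LawF

/-- Value-group bookkeeping for the invariant generators: `(v₀^ℓ)^{m₀} (v₁ v₀^{n₁})^{m₁} (v₂ v₀^{n₂})^{m₂}
= v₀^{ℓ m₀ + n₁ m₁ + n₂ m₂} v₁^{m₁} v₂^{m₂}`. [folklore] -/
theorem zpow_monomial_rearrange {Γ : Type*} [CommGroupWithZero Γ] (v₀ v₁ v₂ : Γ) (hv₀ : v₀ ≠ 0)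
    {ℓ n₁ n₂ : ℕ} {m₀ m₁ m₂ : ℤ} :
    (v₀ ^ ℓ) ^ m₀ * (v₁ * v₀ ^ n₁) ^ m₁ * (v₂ * v₀ ^ n₂) ^ m₂ =
      v₀ ^ ((ℓ : ℤ) * m₀ + (n₁ : ℤ) * m₁ + (n₂ : ℤ) * m₂) * v₁ ^ m₁ * v₂ ^ m₂ := by
  rw [zpow_add₀ hv₀, zpow_add₀ hv₀, zpow_mul, zpow_mul, zpow_mul, zpow_natCast, zpow_natCast,
    zpow_natCast, mul_zpow, mul_zpow]
  simp only [mul_assoc, mul_comm, mul_left_comm]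

variable {k : Type} [Field k] {K : Type} [Field K] [Algebra k K]

set_option maxHeartbeats 800000 in
/-- **(K-e″) LAW-F — THE DATUM-PRODUCING LAW FOR A GENERAL DIAGONAL TAME ACTION (frame NOT given in
advance), decided modulo THEOREM D.**  As LAW-E, but the value-adapted regular chart `(A, x₀, …, x₃)` of
`(K', v')` is only required to be an EIGEN-chart for `σ` with ARBITRARY characters
`σ x_j = ζ^{t_j} x_j`, `t₀ = 1` (no coordinate is assumed `σ`-fixed: NONE of the downstairs frame is
given in advance).  The downstairs sub-top is COMPUTED as the field of invariant monomials
`F'^σ = k(W)`, `W = (x₀^ℓ, x_j x₀^{(ℓ-1)t_j})` (PART C2: `fixed_iff_mem_adjoin_invGen`, the explicit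
Hermite basis of the invariant exponent lattice), which is purely transcendental
(`algebraicIndependent_invGen`) with value data `v W₀ = ℓ v x₀`, `v W_j = v x_j + (ℓ-1)t_j v x₀`
(still independent and spanning), hence monomially rational and key-chain by THEOREM D;
`K' = k(W)(x₀, η')` gives finiteness and separability.  Combined with PART B
(`eigenFrame_of_stableFlag`: a `σ`-stable flag chart is straightened to an eigen-chart by the
isotypic projectors) this is tame coming-down from a BARE upstairs chart with one-step data.
[CossartPiltant2008, Prop. 6.2, Thm. 6.5] [Grothendieck1967, Prop. 18.4.6 (ii)]
[KnafKuhlmann2005 = arXiv:math/0304201, Thm. 1.1] [folklore] -/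
theorem galoisHenselDescentDatum_of_diagonalChart (hD : TheoremD k) (O : ValuationSubring K)
    (hr : Nonempty O.valuation.RankOne)
    (K' : IntermediateField K (AlgebraicClosure K)) [FiniteDimensional K K'] [IsGalois K K']
    (σ : K' ≃ₐ[K] K') (hcyc : ∀ g : K' ≃ₐ[K] K', ∃ i : ℕ, g = σ ^ i)
    {ℓ : ℕ} (hℓ : 0 < ℓ) (hℓk : (ℓ : k) ≠ 0) {ζ : k} (hζ : IsPrimitiveRoot ζ ℓ)
    (O' : ValuationSubring K') (hO'O : O'.comap (algebraMap K K') = O)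
    (hσO' : ∀ y : K', y ∈ O' ↔ σ y ∈ O')
    (hκ' : ∀ y ∈ O', ∃ c : k, y - algebraMap k K' c ∈ O'.nonunits)
    (A : Subalgebra k K') (hAO : A.toSubring ≤ O'.toSubring) (x : Fin 4 → K') (hx : ∀ i, x i ∈ A)
    (hAfg : A.FG) (hfrac : IsFractionRing A K')
    (hreg : IsRegularLocalRing (Localization.AtPrime (centreIdeal A O' hAO)))
    (hdim : ringKrullDim (Localization.AtPrime (centreIdeal A O' hAO)) = 4)
    (hmax : IsLocalRing.maximalIdeal (Localization.AtPrime (centreIdeal A O' hAO)) =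
      Ideal.span (Set.range fun i =>
        algebraMap A (Localization.AtPrime (centreIdeal A O' hAO)) ⟨x i, hx i⟩))
    (hind : ∀ m : Fin 3 → ℤ, (∏ i : Fin 3, O'.valuation (x (Fin.castSucc i)) ^ m i) = 1 → m = 0)
    (hspan : ∀ z : K', z ≠ 0 → ∃ E : ℕ, 0 < E ∧ ∃ m : Fin 3 → ℤ,
      O'.valuation z ^ E = ∏ i : Fin 3, O'.valuation (x (Fin.castSucc i)) ^ m i)
    (t : Fin 4 → ℕ) (ht0 : t 0 = 1) (heig : ∀ j, σ (x j) = algebraMap k K' (ζ ^ t j) * x j) :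
    GaloisHenselDescentDatum k O := by
  haveI := hfrac
  subst hO'O
  have hAO' : ∀ a : A, (a : K') ∈ O' := fun a => hAO a.2
  have hmem𝔔 : ∀ a : A, a ∈ centreIdeal A O' hAO ↔ O'.valuation (a : K') < 1 := fun a =>
    KeyChainLU.mem_centreIdeal_iff A hAO a
  -- (1) the parameter algebra `P = k[X₀..X₃] → A` and the standard-étale neighbourhood (THEOREM H)
  let P := MvPolynomial (Fin 4) k
  let u' : Fin 4 → A := fun i => ⟨x i, hx i⟩
  letI algPA : Algebra P A := (MvPolynomial.aeval u').toRingHom.toAlgebra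
  have halgPA : ∀ q : P, algebraMap P A q = MvPolynomial.aeval u' q := fun _ => rfl
  haveI : IsScalarTower k P A := IsScalarTower.of_algebraMap_eq fun c => by
    rw [halgPA, MvPolynomial.algebraMap_eq, MvPolynomial.aeval_C]
  have hX : ∀ i, algebraMap P A (MvPolynomial.X i) = u' i := fun i => by
    rw [halgPA, MvPolynomial.aeval_X]
  obtain ⟨hinjPA, r, hr𝔔, hstd⟩ :=
    exists_isStandardEtale_of_regularParameters O' A hAO u' hX hAfg hκ' hreg hdim hmax
  have hr1 : O'.valuation (r : K') = 1 := by
    have hle := (O'.valuation_le_one_iff _).mpr (hAO' r)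
    exact (hle.lt_or_eq).resolve_left fun h => hr𝔔 ((hmem𝔔 r).mpr h)
  obtain ⟨Q⟩ := hstd.nonempty_standardEtalePresentation
  have hindu : AlgebraicIndependent k x := by
    rw [algebraicIndependent_iff_injective_aeval]
    have : MvPolynomial.aeval (R := k) x = A.val.comp (MvPolynomial.aeval u') := by
      rw [MvPolynomial.comp_aeval]
      rfl
    rw [this, AlgHom.coe_comp]
    exact Subtype.val_injective.comp hinjPA
  have hx0 : ∀ i, x i ≠ 0 := fun i => hindu.ne_zero i
  -- (2) the upstairs frame `F' = k(x)` and its Hensel generator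
  set F' : IntermediateField k K' := IntermediateField.adjoin k (Set.range x) with hF'def
  have huA : ∀ q : P, ((MvPolynomial.aeval u' q : A) : K') = MvPolynomial.aeval x q := by
    intro q
    change (A.val) (MvPolynomial.aeval u' q) = _
    rw [← AlgHom.comp_apply, MvPolynomial.comp_aeval]
    rfl
  have hPF : ∀ q : P, ((algebraMap P A q : A) : K') ∈ F' := by
    intro q
    rw [halgPA, huA]
    have hmem : MvPolynomial.aeval x q ∈ Algebra.adjoin k (Set.range x) := by
      rw [Algebra.adjoin_range_eq_range_aeval]
      exact ⟨q, rfl⟩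
    exact IntermediateField.algebra_adjoin_le_adjoin k _ hmem
  obtain ⟨η, hηO, hgen, f, hfmon, hfcoeff, hfη, hfder⟩ :=
    henselDatum_of_standardEtalePresentation O' A hAO F' hPF r hr1 Q
  have hxF' : ∀ j, x j ∈ F' := fun j => IntermediateField.subset_adjoin k _ ⟨j, rfl⟩
  -- (3) `σ` as a `k`-automorphism with characters `t`
  let σk : K' ≃ₐ[k] K' := σ.restrictScalars k
  have heigk : ∀ j, σk (x j) = algebraMap k K' (ζ ^ t j) * x j := fun j => heig j
  -- (4) `G = ⟨σ⟩`: stability of `O'` and of `F'` under the whole group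
  have hgO' : ∀ g : K' ≃ₐ[K] K', ∀ y : K', y ∈ O' ↔ g y ∈ O' := by
    intro g y
    obtain ⟨i, rfl⟩ := hcyc g
    induction i generalizing y with
    | zero => simp
    | succ i ih => rw [pow_succ_apply, ← hσO']; exact ih y
  have hσF' : ∀ y ∈ F', σ y ∈ F' := by
    intro y hy
    have h1 : σk y ∈ F'.map σk.toAlgHom := ⟨y, hy, rfl⟩
    rw [hF'def, IntermediateField.adjoin_map] at h1
    refine (IntermediateField.adjoin_le_iff.mpr ?_) h1
    rintro _ ⟨_, ⟨j, rfl⟩, rfl⟩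
    change σk (x j) ∈ (F' : Set K')
    rw [heigk j]
    exact F'.mul_mem (F'.algebraMap_mem _) (hxF' j)
  have hgF' : ∀ g : K' ≃ₐ[K] K', ∀ y ∈ F'.toSubfield, g y ∈ F'.toSubfield := by
    intro g y hy
    obtain ⟨i, rfl⟩ := hcyc g
    induction i generalizing y with
    | zero => simpa using hy
    | succ i ih => rw [pow_succ_apply]; exact hσF' _ (ih y hy)
  -- (5) residue clause for `η`
  obtain ⟨c, hc⟩ := hκ' η hηO
  -- (6) the invariant frame `W = (x₀^ℓ, x_j x₀^{(ℓ-1)t_j})` descends to `K`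
  let w : Fin 4 → K' := invGen x ℓ t
  have hw0 : w 0 = x 0 ^ ℓ := invGen_zero x ℓ t
  have hwsucc : ∀ i : Fin 3, w i.succ = x i.succ * x 0 ^ ((ℓ - 1) * t i.succ) := invGen_succ x ℓ t
  have hσw : ∀ j, σ (w j) = w j := fun j => sigma_invGen σk x hℓ hζ.pow_eq_one t ht0 heigk j
  have hgw : ∀ (g : K' ≃ₐ[K] K') (j : Fin 4), g (w j) = w j := by
    intro g j
    obtain ⟨i, rfl⟩ := hcyc g
    induction i with
    | zero => simp
    | succ i ih => rw [pow_succ_apply, ih, hσw]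
  have hwK : ∀ j, ∃ yj : K, algebraMap K K' yj = w j := fun j =>
    IntermediateField.mem_bot.mp ((IsGalois.mem_bot_iff_fixed (w j)).mpr fun g => hgw g j)
  choose y hy using hwK
  have hwA : ∀ j, w j ∈ A := invGen_mem x ℓ t A hx
  have hwO' : ∀ j, w j ∈ O' := fun j => hAO (hwA j)
  have hwne : ∀ j, w j ≠ 0 := invGen_ne_zero x hx0 ℓ t
  have hwF' : ∀ j, w j ∈ F' := invGen_mem x ℓ t F'.toSubalgebra hxF'
  -- (7) the downstairs sub-top `F₁ = k(y)`, `ι(F₁) = k(w) = F'^σ`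
  set ι := algebraMap K K' with hιdef
  set F₁ : IntermediateField k K := IntermediateField.adjoin k (Set.range y) with hF₁def
  let ιk : K →ₐ[k] K' := IsScalarTower.toAlgHom k K K'
  have hιk : ∀ z, ιk z = ι z := fun _ => rfl
  have hmapF₁ : F₁.map ιk = IntermediateField.adjoin k (Set.range w) := by
    rw [hF₁def, IntermediateField.adjoin_map]
    congr 1
    ext z
    constructor
    · rintro ⟨_, ⟨j, rfl⟩, rfl⟩
      exact ⟨j, (hy j).symm⟩
    · rintro ⟨j, rfl⟩
      exact ⟨y j, ⟨j, rfl⟩, hy j⟩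
  have hadjw_le : IntermediateField.adjoin k (Set.range w) ≤ F' :=
    IntermediateField.adjoin_le_iff.mpr (by rintro _ ⟨j, rfl⟩; exact hwF' j)
  have hyF₁ : ∀ j, y j ∈ F₁ := fun j => IntermediateField.subset_adjoin k _ ⟨j, rfl⟩
  have hwL₀ : ∀ j, w j ∈ F₁.map ιk := fun j => ⟨y j, hyF₁ j, hy j⟩
  have hF₁F' : ∀ z : K, algebraMap K K' z ∈ F'.toSubfield ↔ z ∈ F₁ := by
    intro z
    constructor
    · intro hz
      have hzF : ι z ∈ F₁.map ιk := by
        rw [hmapF₁]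
        exact (fixed_iff_mem_adjoin_invGen σk hℓ hℓk hζ x hx0 t ht0 heigk (z := ι z) hz).mp
          (σ.commutes z)
      rw [IntermediateField.mem_map] at hzF
      obtain ⟨z', hz', hzz'⟩ := hzF
      have hz'z : z' = z := (algebraMap K K').injective hzz'
      rw [← hz'z]
      exact hz'
    · intro hz
      have h1 : ι z ∈ F₁.map ιk := ⟨z, hz, rfl⟩
      rw [hmapF₁] at h1
      exact hadjw_le h1
  -- (8) the base `O ∩ F₁` is rank one, residually rational and MONOMIALLY RATIONAL; THEOREM D
  have hyO : ∀ j, y j ∈ O'.comap ι := fun j => by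
    rw [ValuationSubring.mem_comap, hy]; exact hwO' j
  have hy0 : ∀ j, y j ≠ 0 := fun j h => hwne j (by rw [← hy, h, map_zero])
  have hx00 : O'.valuation (x 0) < 1 :=
    (hmem𝔔 (u' 0)).mp (by
      have h := hmax ▸ (Ideal.subset_span ⟨0, rfl⟩ :
        algebraMap A (Localization.AtPrime (centreIdeal A O' hAO)) (u' 0) ∈
          Ideal.span (Set.range fun i =>
            algebraMap A (Localization.AtPrime (centreIdeal A O' hAO)) (u' i)))
      exact (IsLocalization.AtPrime.to_map_mem_maximal_iff _ (centreIdeal A O' hAO) (u' 0)).mp h)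
  have hy00 : (O'.comap ι).valuation
      (algebraMap F₁ K ⟨y 0, hyF₁ 0⟩) < 1 := by
    rw [AdaptedChartHensel.comap_valuation_lt_one_iff]
    change O'.valuation (ι (y 0)) < 1
    rw [hy, hw0, map_pow]
    exact pow_lt_one₀ zero_le hx00 hℓ.ne'
  have hrF : Nonempty ((O'.comap ι).comap (algebraMap F₁ K)).valuation.RankOne :=
    rankOne_comap (algebraMap F₁ K) (O'.comap ι) hr (c := ⟨y 0, hyF₁ 0⟩)
      (fun h => hy0 0 (congrArg Subtype.val h)) hy00
  have hκ : ∀ z ∈ O'.comap ι, ∃ c : k, z - algebraMap k K c ∈ (O'.comap ι).nonunits := by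
    intro z hz
    obtain ⟨c', hc'⟩ := hκ' (ι z) (ValuationSubring.mem_comap.mp hz)
    refine ⟨c', ?_⟩
    rw [ValuationSubring.mem_nonunits_iff, AdaptedChartHensel.comap_valuation_lt_one_iff, map_sub, hιdef,
      ← IsScalarTower.algebraMap_apply k K K']
    exact (O'.mem_nonunits_iff).mp hc'
  have hκF : ∀ z ∈ (O'.comap ι).comap (algebraMap F₁ K), ∃ c : k,
      z - algebraMap k F₁ c ∈ ((O'.comap ι).comap (algebraMap F₁ K)).nonunits := by
    intro z hz
    obtain ⟨c', hc'⟩ := hκ (algebraMap F₁ K z) (ValuationSubring.mem_comap.mp hz)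
    refine ⟨c', ?_⟩
    rw [ValuationSubring.mem_nonunits_iff, AdaptedChartHensel.comap_valuation_lt_one_iff, map_sub,
      ← IsScalarTower.algebraMap_apply k F₁ K c']
    exact ((O'.comap ι).mem_nonunits_iff).mp hc'
  -- algebraic independence of `W` (PART C2) and of `y`
  have hindw : AlgebraicIndependent k w := algebraicIndependent_invGen hindu hℓ t
  have hindy : AlgebraicIndependent k y :=
    AlgebraicIndependent.of_comp ιk (by
      have : ιk ∘ y = w := funext fun j => hy j
      rw [this]
      exact hindw)
  -- the value clauses of `y` (from those of `x`: `v W₀ = ℓ v x₀`, `v W_j = v x_j + (ℓ-1)t_j v x₀`)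
  have hv0 : O'.valuation (x 0) ≠ 0 := (Valuation.ne_zero_iff _).mpr (hx0 0)
  have h0 : (Fin.castSucc (0 : Fin 3) : Fin 4) = 0 := rfl
  have h1 : (Fin.castSucc (1 : Fin 3) : Fin 4) = (0 : Fin 3).succ := rfl
  have h2 : (Fin.castSucc (2 : Fin 3) : Fin 4) = (1 : Fin 3).succ := rfl
  have hwx : ∀ m : Fin 3 → ℤ, (∏ i : Fin 3, O'.valuation (w (Fin.castSucc i)) ^ m i) =
      ∏ i : Fin 3, O'.valuation (x (Fin.castSucc i)) ^
        (fun i : Fin 3 => if i = 0 then (ℓ : ℤ) * m 0 +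
          (((ℓ - 1) * t (0 : Fin 3).succ : ℕ) : ℤ) * m 1 +
          (((ℓ - 1) * t (1 : Fin 3).succ : ℕ) : ℤ) * m 2 else m i) i := by
    intro m
    simp only [Fin.prod_univ_three]
    rw [h0, h1, h2, hw0, hwsucc, hwsucc, map_mul, map_mul, map_pow, map_pow, map_pow,
      zpow_monomial_rearrange _ _ _ hv0]
    simp
  have hyw : ∀ m : Fin 3 → ℤ,
      ι (∏ i : Fin 3, y (Fin.castSucc i) ^ m i) = ∏ i : Fin 3, w (Fin.castSucc i) ^ m i := by
    intro m
    rw [map_prod]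
    simp only [map_zpow₀, ← hy]
  have hind_y : ∀ m : Fin 3 → ℤ,
      (∏ i : Fin 3, (O'.comap ι).valuation (y (Fin.castSucc i)) ^ m i) = 1 → m = 0 := by
    intro m hm
    rw [prod_valuation_zpow_eq, AdaptedChartHensel.comap_valuation_eq_one_iff, hyw,
      ← prod_valuation_zpow_eq, hwx] at hm
    have h := hind _ hm
    have hm1 : m 1 = 0 := by simpa using congr_fun h 1
    have hm2 : m 2 = 0 := by simpa using congr_fun h 2
    have hm0' : (ℓ : ℤ) * m 0 = 0 := by simpa [hm1, hm2] using congr_fun h 0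
    have hm0 : m 0 = 0 := (mul_eq_zero.mp hm0').resolve_left (by exact_mod_cast hℓ.ne')
    funext i
    fin_cases i
    · exact hm0
    · exact hm1
    · exact hm2
  have hspan_y : ∀ z : K, z ≠ 0 → ∃ E : ℕ, 0 < E ∧ ∃ m : Fin 3 → ℤ,
      (O'.comap ι).valuation z ^ E =
        ∏ i : Fin 3, (O'.comap ι).valuation (y (Fin.castSucc i)) ^ m i := by
    intro z hz0
    obtain ⟨E, hE, n, hn⟩ := hspan (ι z) ((_root_.map_ne_zero ι).mpr hz0)
    refine ⟨E * ℓ, Nat.mul_pos hE hℓ, fun i => if i = 0 then n 0 -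
      (((ℓ - 1) * t (0 : Fin 3).succ : ℕ) : ℤ) * n 1 -
      (((ℓ - 1) * t (1 : Fin 3).succ : ℕ) : ℤ) * n 2 else (ℓ : ℤ) * n i, ?_⟩
    rw [prod_valuation_zpow_eq, ← map_pow, AdaptedChartHensel.comap_valuation_eq_iff, map_pow, map_pow,
      hyw, ← prod_valuation_zpow_eq, hwx, pow_mul, hn, ← Finset.prod_pow]
    refine Finset.prod_congr rfl fun i _ => ?_
    rw [← zpow_natCast, ← zpow_mul]
    congr 1
    fin_cases i
    · simp; ring
    · simp [mul_comm]
    · simp [mul_comm]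
  have hMR : MonomiallyRational k ((O'.comap ι).comap (algebraMap F₁ K)) :=
    monomiallyRational_comap_adjoin (O'.comap ι) y hyO hy0 hindy hind_y hspan_y
  have hkey : KeyChainTopBelow k ((O'.comap ι).comap (algebraMap F₁ K)) :=
    hD F₁ ((O'.comap ι).comap (algebraMap F₁ K)) hrF hκF hMR
  -- (9) `[K : F₁] < ∞` and `K | F₁` separable, through `K' = k(W)(x₀, η')`
  set L₀ : IntermediateField k K' := F₁.map ιk with hL₀def
  have hℓK' : ((ℓ : ℕ) : K') ≠ 0 := by
    rw [← map_natCast (algebraMap k K')]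
    exact (_root_.map_ne_zero _).mpr hℓk
  have hx0L : IsIntegral L₀ (x 0) ∧ IsSeparable L₀ (x 0) :=
    isIntegral_and_isSeparable_of_pow_mem L₀ (x 0) hℓ hℓK' (hx0 0) (hw0 ▸ hwL₀ 0)
  -- `F' ⊆ L₀(x₀)`
  set L₁ : IntermediateField L₀ K' := IntermediateField.adjoin L₀ {x 0} with hL₁def
  have hF'L₁ : ∀ z ∈ F', z ∈ L₁ := by
    have hle : F' ≤ L₁.restrictScalars k := by
      rw [hF'def]
      refine IntermediateField.adjoin_le_iff.mpr ?_
      rintro _ ⟨j, rfl⟩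
      by_cases hj : j = 0
      · subst hj
        exact IntermediateField.subset_adjoin L₀ _ (Set.mem_singleton _)
      · obtain ⟨i, rfl⟩ : ∃ i : Fin 3, j = i.succ := ⟨j.pred hj, (Fin.succ_pred j hj).symm⟩
        have hx0L₁ : x 0 ∈ L₁ := IntermediateField.subset_adjoin L₀ _ (Set.mem_singleton _)
        have hpow : x 0 ^ ((ℓ - 1) * t i.succ) ≠ 0 := pow_ne_zero _ (hx0 0)
        have : x i.succ = algebraMap L₀ K' ⟨w i.succ, hwL₀ i.succ⟩ * (x 0 ^ ((ℓ - 1) * t i.succ))⁻¹ := by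
          rw [eq_mul_inv_iff_mul_eq₀ hpow, ← hwsucc]; rfl
        rw [this]
        exact L₁.mul_mem (L₁.algebraMap_mem _) (L₁.inv_mem (pow_mem hx0L₁ _))
    exact fun z hz => hle hz
  have hηL₁ : IsIntegral L₁ η ∧ IsSeparable L₁ η :=
    isIntegral_and_isSeparable_of_simple_root L₁ η f (fun i => hF'L₁ _ (hfcoeff i).2) hfmon hfη
      (by rw [← O'.valuation.ne_zero_iff, hfder]; exact one_ne_zero)
  haveI : Algebra.IsSeparable L₀ L₁ :=
    (IntermediateField.isSeparable_adjoin_simple_iff_isSeparable L₀ K').mpr hx0L.2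
  haveI : FiniteDimensional L₀ L₁ := IntermediateField.adjoin.finiteDimensional hx0L.1
  haveI : Algebra.IsIntegral L₀ L₁ := Algebra.IsIntegral.of_finite L₀ L₁
  have hηL₀sep : IsSeparable L₀ η := IsSeparable.of_algebra_isSeparable_of_isSeparable L₀ hηL₁.2
  have hηL₀int : IsIntegral L₀ η := isIntegral_trans η hηL₁.1
  -- `K' = L₀(x₀, η)`
  set E₀ : IntermediateField L₀ K' := IntermediateField.adjoin L₀ {x 0, η} with hE₀def
  have hL₁E₀ : L₁ ≤ E₀ := IntermediateField.adjoin.mono L₀ _ _ (Set.singleton_subset_iff.mpr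
    (Set.mem_insert _ _))
  have hE₀top : E₀ = ⊤ := by
    refine eq_top_iff.mpr fun z _ => ?_
    have hz : z ∈ Subfield.closure ((F'.toSubfield : Set K') ∪ {η}) := by
      rw [hgen]; exact Subfield.mem_top z
    refine (Subfield.closure_le (t := E₀.toSubfield)).mpr ?_ hz
    rintro a (ha | ha)
    · exact hL₁E₀ (hF'L₁ a ha)
    · rw [Set.mem_singleton_iff.mp ha]
      exact IntermediateField.subset_adjoin L₀ _ (Set.mem_insert_of_mem _ (Set.mem_singleton _))
  haveI hE₀fin : FiniteDimensional L₀ E₀ := by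
    refine IntermediateField.finiteDimensional_adjoin fun z hz => ?_
    rcases hz with rfl | hz
    · exact hx0L.1
    · rw [Set.mem_singleton_iff.mp hz]; exact hηL₀int
  haveI hE₀sep : Algebra.IsSeparable L₀ E₀ :=
    IntermediateField.isSeparable_adjoin_pair_of_isSeparable L₀ K' hx0L.2 hηL₀sep
  let eE : E₀ ≃ₐ[L₀] K' := (IntermediateField.equivOfEq hE₀top).trans IntermediateField.topEquiv
  haveI hK'fin : FiniteDimensional L₀ K' := LinearEquiv.finiteDimensional eE.toLinearEquiv
  haveI hK'sep : Algebra.IsSeparable L₀ K' :=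
    Algebra.IsSeparable.of_algHom L₀ _ (eE.symm : K' →ₐ[L₀] E₀)
  -- transport along `F₁ ≅ L₀`
  let e₁ : L₀ ≃+* F₁ := (F₁.equivMap ιk).symm.toRingEquiv
  have he' : ∀ z : L₀, algebraMap F₁ K' ((F₁.equivMap ιk).symm z) = (z : K') := by
    intro z
    have h1 : ((F₁.equivMap ιk) ((F₁.equivMap ιk).symm z) : K') = (z : K') := by
      rw [AlgEquiv.apply_symm_apply]
    rw [IntermediateField.coe_equivMap_apply] at h1
    rw [← h1]
    rfl
  have he : RingHom.comp (algebraMap F₁ K') (e₁ : L₀ →+* F₁) =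
      RingHom.comp ((RingEquiv.refl K' : K' ≃+* K') : K' →+* K') (algebraMap L₀ K') :=
    RingHom.ext fun z => he' z
  haveI : Module.Finite F₁ K' := Module.Finite.of_equiv_equiv e₁ (RingEquiv.refl K') he
  haveI : Algebra.IsSeparable F₁ K' := Algebra.IsSeparable.of_equiv_equiv e₁ (RingEquiv.refl K') he
  have hfinK : FiniteDimensional F₁ K :=
    FiniteDimensional.of_injective (IsScalarTower.toAlgHom F₁ K K').toLinearMap
      (algebraMap K K').injective
  have hsepK : Algebra.IsSeparable F₁ K := Algebra.isSeparable_tower_bot_of_isSeparable F₁ K K'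
  -- (10) assemble the datum
  exact ⟨F₁, IntermediateField.fg_adjoin_of_finite (Set.finite_range y), hkey, hfinK, hsepK, K',
    ‹FiniteDimensional K K'›, ‹IsGalois K K'›, O', rfl, hgO', F'.toSubfield, hgF', hF₁F', η, hηO,
    ⟨algebraMap k K' c, F'.algebraMap_mem c, hc⟩, hgen, f, hfcoeff, hfη, hfder⟩

end LawF

end Summit.ResolutionOfSingularities.ResolutionOfSingularities.Theorems.EigenLadderLU
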